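import Literature.NumberTheory.LFunctions.PageUniformPNT
import Literature.NumberTheory.LFunctions.SiegelExceptionalZeroBound
import Literature.NumberTheory.LFunctions.GeneralizedRH
import HarnessLib

/-!
# Page's theorem with the exceptional CONDUCTOR removed, and the prime number theorem for
# progressions uniformly for `log q ≤ (log X)^b`, `b < 1/4`, all `x ≥ X`, `d ∤ q`

Topic `Literature/NumberTheory/LFunctions`. Everything in this file is PROVED (theorems only); it is
a variant of `PageUniformPNT.lean` (same proofs, same constants) needed by Maier-matrix arguments in
which the prime number theorem for progressions is applied at MANY heights `x` with ONE exceptional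
object, and in which the exceptional object must be known to be LARGE (Friedlander–Granville,
*Limitations to the equi-distribution of primes III*, Compositio Math. 81 (1992), §4 Proposition 2:
"k divides r for every bad modulus rP_a(z)" — the device of removing a divisor of the exceptional
conductor from the sieving modulus). The tree's `PageUniformPNT.chebyshevPsiMod_uniform` exposes only
a prime `B = B(x)` (the least prime factor of the exceptional conductor) depending on the height `x`;
here we expose the conductor `d` itself, make it depend on a scale `X` only, and record Siegel's
lower bound for it.

* `exists_exceptionalConductor` — **Page's theorem, conductor form** (Landau 1918; MV Cor. 11.8–11.10;
  Davenport Ch. 14): an absolute `c_P ∈ (0, 1/2]` such that for every `T ≥ 1` there is `d : ℕ`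
  — either `d = 0` ("no exceptional character": then `d ∤ q` for every `q ≥ 1`), or `d` is the
  conductor of a quadratic character `χ₀` mod `q₀`, `log q₀ ≤ T`, having a real zero
  `β₀ > 1 − c_P/T` — with the property: for every modulus `q ≥ 1` with `log q ≤ T` and `d ∤ q`,
  every real zero `β` of every quadratic non-principal `L(s, χ)` mod `q` has `1 − β ≥ c_P/T`.
  (Proof as for `PageUniformPNT.exists_exceptionalPrime`: a second bad pair `(χ mod q, β)` gives
  either a non-principal `χ₀χ` contradicting Landau's `exists_landau_min_le`, or `χ₀χ` principal,
  whence `χ₀` factors through `gcd(q₀, q)` and `d ∣ q`.)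
* `exceptionalConductor_ge` — **the exceptional conductor is large** (Siegel; MV Cor. 11.15 in the
  tree's form `Siegel.exists_one_sub_realZero_ge`, applied to the primitive character inducing `χ₀`,
  whose `L`-function has the same real zeros in `(0,1)`,
  `DirichletCharacter.LFunction_eq_zero_iff_primitiveCharacter`): for every `A > 0` and all
  `T ≥ T₀(A)`, a conductor `d` as above satisfies `d ≥ T^A`. (Friedlander–Granville §4: "we may
  assume `d ≥ z^A` for any fixed `A` … choosing `ε = 1/2A` in Siegel's theorem".) Ineffective.
* `chebyshevPsiMod_uniform_conductor` — **the PNT for progressions outside the exceptional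
  conductor, uniformly in the height**: for `0 < b < 1/4`, `ε > 0`, `A > 0` and all large `X` there
  is `d : ℕ` with `d = 0 ∨ d ≥ (log X)^A` such that `|ψ(x; q, a) − x/φ(q)| ≤ ε x/φ(q)` for ALL
  `x ≥ X`, all `1 ≤ q`, `log q ≤ (log X)^b`, `d ∤ q`, `(a, q) = 1`. (Same proof as
  `PageUniformPNT.chebyshevPsiMod_uniform`, with `T = (log X)^b` fixed and
  `exp(−c√log x) ≤ exp(−c√log X)` for `x ≥ X`.)

## References

* H. L. Montgomery, R. C. Vaughan, *Multiplicative Number Theory I*, CUP 2007: Theorem 11.7 and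
  Corollaries 11.8–11.10 (§11.2), Corollary 11.15, Theorem 11.16 and Corollary 11.17 (§11.3)
  (`MontgomeryVaughan2007`).
* J. Friedlander, A. Granville, *Limitations to the equi-distribution of primes III*, Compositio
  Math. 81 (1992), 19–32, §4 (good and bad moduli, Proposition 2) (`FriedlanderGranville1992`).
* K. Ford, J. Maynard, T. Tao, *Chains of large gaps between primes* (2018), §2 (`FordMaynardTao2018`).
-/

noncomputable section

open Complex Filter Topology Metric Set Finset
open scoped LSeries.notation ArithmeticFunction.vonMangoldt

namespace Literature.NumberTheory.LFunctions.PageUniformPNT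

/-! ## Page's theorem: the exceptional conductor -/

/-- **Page's theorem, conductor form** (Landau; Montgomery–Vaughan Cor. 11.8–11.10): there is an
absolute constant `c_P ∈ (0, 1/2]` such that for every `T ≥ 1` there is a natural number `d` with:
either `d = 0`, or `d` is the conductor of a quadratic non-principal character `χ₀` of some modulus
`q₀` with `log q₀ ≤ T` having a real zero `β₀` with `1 − β₀ < c_P/T`; and for all moduli `q ≥ 1`
with `log q ≤ T` and `d ∤ q`, all quadratic non-principal `χ` mod `q` and all real zeros `β` of
`L(s, χ)`: `c_P / T ≤ 1 − β`. [cite: MontgomeryVaughan2007, Corollaries 11.8–11.10]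
[cite: FriedlanderGranville1992, §4 (good and bad moduli)] -/
theorem exists_exceptionalConductor :
    ∃ cP : ℝ, 0 < cP ∧ cP ≤ 1 / 2 ∧ ∀ T : ℝ, 1 ≤ T → ∃ d : ℕ,
      (d = 0 ∨ ∃ (q₀ : ℕ) (_ : NeZero q₀) (χ₀ : DirichletCharacter ℂ q₀) (β₀ : ℝ),
          Real.log q₀ ≤ T ∧ χ₀ ^ 2 = 1 ∧ χ₀ ≠ 1 ∧ χ₀.LFunction β₀ = 0 ∧ 1 - β₀ < cP / T ∧
            d = χ₀.conductor) ∧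
      ∀ (q : ℕ) [NeZero q], Real.log q ≤ T → ¬ d ∣ q →
        ∀ χ : DirichletCharacter ℂ q, χ ^ 2 = 1 → χ ≠ 1 →
          ∀ β : ℝ, χ.LFunction β = 0 → cP / T ≤ 1 - β := by
  classical
  obtain ⟨c, hc, H⟩ := DirichletZFR.exists_landau_min_le
  have hcP0 : 0 < min (c / 5) (1 / 2) := lt_min (by positivity) (by norm_num)
  have hcPc : min (c / 5) (1 / 2) ≤ c / 5 := min_le_left _ _
  refine ⟨min (c / 5) (1 / 2), hcP0, min_le_right _ _, fun T hT ↦ ?_⟩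
  have hT0 : 0 < T := by linarith
  by_cases hex : ∃ (q₀ : ℕ) (_ : NeZero q₀) (χ₀ : DirichletCharacter ℂ q₀) (β₀ : ℝ),
      Real.log q₀ ≤ T ∧ χ₀ ^ 2 = 1 ∧ χ₀ ≠ 1 ∧ χ₀.LFunction β₀ = 0 ∧ 1 - β₀ < min (c / 5) (1 / 2) / T
  swap
  · -- no exceptional character at all: `d = 0`
    refine ⟨0, Or.inl rfl, fun q _ hqT _ χ hχ2 hχ1 β hβ ↦ ?_⟩
    by_contra hlt
    exact hex ⟨q, inferInstance, χ, β, hqT, hχ2, hχ1, hβ, by linarith⟩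
  obtain ⟨q₀, _, χ₀, β₀, hq₀T, hχ₀2, hχ₀1, hβ₀, hβ₀lt⟩ := hex
  refine ⟨χ₀.conductor, Or.inr ⟨q₀, inferInstance, χ₀, β₀, hq₀T, hχ₀2, hχ₀1, hβ₀, hβ₀lt, rfl⟩,
    fun q _ hqT hndvd χ hχ2 hχ1 β hβ ↦ ?_⟩
  by_contra hlt
  push Not at hlt
  by_cases hψ : SiegelCoefficients.prodChar χ₀ χ = 1
  · -- `χ₀χ` principal: `χ₀` factors through `gcd(q₀, q)`, so `conductor χ₀ ∣ q`
    have hinv : χ⁻¹ = χ := by rw [inv_eq_iff_mul_eq_one, ← sq, hχ2]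
    have H' : χ₀.changeLevel (dvd_mul_right q₀ q) = χ.changeLevel (dvd_mul_left q q₀) := by
      have := eq_inv_of_mul_eq_one_left hψ
      rw [← map_inv, hinv] at this
      exact this
    have hft := DirichletCharacter.factorsThrough_gcd χ₀ χ H'
    have hdvd : χ₀.conductor ∣ q :=
      (DirichletCharacter.conductor_dvd_of_mem_conductorSet χ₀ hft).trans (Nat.gcd_dvd_right q₀ q)
    exact hndvd hdvd
  · -- Landau's repulsion for the non-principal `χ₀χ` (mod `q₀q`)
    haveI : NeZero (q₀ * q) := ⟨Nat.mul_ne_zero (NeZero.ne q₀) (NeZero.ne q)⟩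
    have h := H q₀ q (q₀ * q) χ₀ χ (SiegelCoefficients.prodChar χ₀ χ) hχ₀1 hχ1 hψ hχ₀2 hχ2
      (fun n ↦ SiegelCoefficients.prodChar_apply_natCast χ₀ χ n)
      (Nat.le_mul_of_pos_right q₀ (NeZero.pos q)) (Nat.le_mul_of_pos_left q (NeZero.pos q₀))
      β₀ β hβ₀ hβ
    have hq₀0 : (0 : ℝ) < q₀ := by exact_mod_cast NeZero.pos q₀
    have hq0 : (0 : ℝ) < q := by exact_mod_cast NeZero.pos q
    have hlogmul : Real.log ((q₀ * q : ℕ) : ℝ) = Real.log q₀ + Real.log q := by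
      push_cast
      exact Real.log_mul hq₀0.ne' hq0.ne'
    have hsum : Real.log ((q₀ * q : ℕ) : ℝ) + Real.log 4 ≤ 5 * T := by
      rw [hlogmul]
      linarith [log_four_le_three]
    have hpos : 0 < Real.log ((q₀ * q : ℕ) : ℝ) + Real.log 4 := by
      have h1 : 0 ≤ Real.log ((q₀ * q : ℕ) : ℝ) := Real.log_natCast_nonneg _
      have h2 : 0 < Real.log 4 := Real.log_pos (by norm_num)
      linarith
    have hle : c / 5 / T ≤ c / (Real.log ((q₀ * q : ℕ) : ℝ) + Real.log 4) := by
      rw [div_div]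
      exact div_le_div_of_nonneg_left hc.le hpos hsum
    have hmono : min (c / 5) (1 / 2) / T ≤ c / 5 / T := div_le_div_of_nonneg_right hcPc hT0.le
    have hmin : 1 - c / 5 / T < min β₀ β := lt_min (by linarith) (by linarith)
    linarith

/-- **The exceptional conductor is large** (Siegel's theorem in the form of Montgomery–Vaughan
Cor. 11.15, tree: `Siegel.exists_one_sub_realZero_ge`; Friedlander–Granville 1992, §4: "we may
assume `d ≥ z^A` for any fixed `A` and `z > z₀(A)` since, if not, choosing `ε = 1/2A` in Siegel's
theorem we would obtain … a contradiction"): for `c_P > 0` and `A > 0` there is `T₀` such that for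
`T ≥ T₀`, if a quadratic non-principal `χ₀` mod `q₀` has a real zero `β₀` with `1 − β₀ < c_P/T`
and `c_P/T ≤ 1/2`, then its conductor satisfies `T^A ≤ conductor χ₀`. (The real zeros in `(0,1)`
of `L(s, χ₀)` and of the primitive `L(s, χ₀⋆)` coincide.) Ineffective.
[cite: MontgomeryVaughan2007, Corollary 11.15] [cite: FriedlanderGranville1992, §4 proof of Proposition 2] -/
theorem exceptionalConductor_ge {cP : ℝ} (hcP : 0 < cP) {A : ℝ} (hA : 0 < A) :
    ∃ T₀ : ℝ, 1 ≤ T₀ ∧ ∀ T : ℝ, T₀ ≤ T → cP / T ≤ 1 / 2 →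
      ∀ (q₀ : ℕ) [NeZero q₀] (χ₀ : DirichletCharacter ℂ q₀) (β₀ : ℝ),
        χ₀ ^ 2 = 1 → χ₀ ≠ 1 → χ₀.LFunction β₀ = 0 → 1 - β₀ < cP / T →
          T ^ A ≤ (χ₀.conductor : ℝ) := by
  obtain ⟨C, hC, hS⟩ := Siegel.exists_one_sub_realZero_ge (ε := 1 / (2 * A)) (by positivity)
  refine ⟨max 1 ((cP / C) ^ 2), le_max_left _ _, fun T hT hhalf q₀ _ χ₀ β₀ hχ₀2 hχ₀1 hβ₀ hlt ↦ ?_⟩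
  have hT1 : 1 ≤ T := (le_max_left _ _).trans hT
  have hT0 : 0 < T := by linarith
  have hTC : (cP / C) ^ 2 ≤ T := (le_max_right _ _).trans hT
  -- the primitive character inducing `χ₀` and its real zero `β₀`
  haveI : NeZero χ₀.conductor := ⟨χ₀.conductor_ne_zero⟩
  set ψ := χ₀.primitiveCharacter with hψdef
  have hχψ : DirichletCharacter.changeLevel χ₀.conductor_dvd_level ψ = χ₀ :=
    DirichletCharacter.changeLevel_primitiveCharacter χ₀
  have hψ1 : ψ ≠ 1 := fun h ↦ hχ₀1 (by rw [← hχψ, h, map_one])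
  have hψsq : ψ ^ 2 = 1 :=
    DirichletCharacter.changeLevel_injective χ₀.conductor_dvd_level
      (by rw [map_pow, hχψ, hχ₀2, map_one])
  have hβ₀pos : 0 < β₀ := by linarith
  have hβ₀ne : (β₀ : ℂ) ≠ 1 := by
    intro h1
    have h1' : β₀ = 1 := by exact_mod_cast h1
    rw [h1'] at hβ₀
    exact DirichletCharacter.LFunction_apply_one_ne_zero hχ₀1 (by exact_mod_cast hβ₀)
  have hψβ : ψ.LFunction β₀ = 0 :=
    (DirichletCharacter.LFunction_eq_zero_iff_primitiveCharacter χ₀ (s := β₀)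
      (by simpa using hβ₀pos) hβ₀ne).mp hβ₀
  -- Siegel: `C d^{-1/(2A)} ≤ 1 − β₀ < cP / T`
  have hSd := hS χ₀.conductor ψ hψsq hψ1 β₀ hψβ
  set d : ℝ := (χ₀.conductor : ℝ) with hddef
  have hd0 : 0 < d := by rw [hddef]; exact_mod_cast Nat.pos_of_ne_zero χ₀.conductor_ne_zero
  have hkey : C * d ^ (-(1 / (2 * A))) < cP / T := hSd.trans_lt hlt
  -- `t := C T / cP < d^{1/(2A)}`
  set t : ℝ := C * T / cP with htdef
  have ht0 : 0 < t := by rw [htdef]; positivity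
  have hdt : t < d ^ (1 / (2 * A)) := by
    have h1 : d ^ (-(1 / (2 * A))) = (d ^ (1 / (2 * A)))⁻¹ := Real.rpow_neg hd0.le _
    rw [h1] at hkey
    have h2 : 0 < d ^ (1 / (2 * A)) := Real.rpow_pos_of_pos hd0 _
    -- `C / d^{1/(2A)} < cP / T` ⟹ `C T / cP < d^{1/(2A)}`
    have h3 : C * T < cP * d ^ (1 / (2 * A)) := by
      have := (mul_inv_lt_iff₀ h2).1 hkey
      -- this : C < cP / T * d ^ (1/(2A))
      have h4 : C * T < cP / T * d ^ (1 / (2 * A)) * T := mul_lt_mul_of_pos_right this hT0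
      calc C * T < cP / T * d ^ (1 / (2 * A)) * T := h4
        _ = cP * d ^ (1 / (2 * A)) := by field_simp
    rw [htdef, div_lt_iff₀ hcP]
    linarith [h3]
  -- `T ≤ t²` and `T^A ≤ (t²)^A = t^{2A} < d`
  have hTt : T ≤ t ^ 2 := by
    have hC0 : 0 < C := hC
    have h1 : t ^ 2 = (C / cP) ^ 2 * T ^ 2 := by rw [htdef]; ring
    have h2 : (cP / C) ^ 2 * (C / cP) ^ 2 = 1 := by field_simp
    have h3 : 0 ≤ (C / cP) ^ 2 := sq_nonneg _
    calc T = (cP / C) ^ 2 * (C / cP) ^ 2 * T := by rw [h2, one_mul]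
      _ ≤ T * (C / cP) ^ 2 * T := by
          have := mul_le_mul_of_nonneg_right hTC (mul_nonneg h3 hT0.le)
          nlinarith [this]
      _ = t ^ 2 := by rw [h1]; ring
  have h2A : 0 < 2 * A := by positivity
  calc T ^ A ≤ (t ^ 2) ^ A := Real.rpow_le_rpow hT0.le hTt hA.le
    _ = t ^ (2 * A) := by
        rw [← Real.rpow_natCast t 2, ← Real.rpow_mul ht0.le]
        norm_num
    _ ≤ (d ^ (1 / (2 * A))) ^ (2 * A) := Real.rpow_le_rpow ht0.le hdt.le h2A.le
    _ = d := by
        rw [← Real.rpow_mul hd0.le, one_div_mul_cancel h2A.ne', Real.rpow_one]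

/-! ## The prime number theorem for progressions outside the exceptional conductor -/

set_option maxHeartbeats 1600000 in
/-- **The prime number theorem for arithmetic progressions outside the exceptional conductor,
uniformly in the height** (Page; Montgomery–Vaughan Cor. 11.17 with Cor. 11.10 and Cor. 11.15; the
"good moduli" of Friedlander–Granville 1992, §4): for `0 < b < 1/4`, `ε > 0` and `A > 0` there is
`X₀` such that for every `X ≥ X₀` there is a natural number `d` with `d = 0` or `d ≥ (log X)^A`,
such that `|ψ(x; q, a) − x/φ(q)| ≤ ε · x/φ(q)` for all `x ≥ X`, all `q ≥ 1` with
`log q ≤ (log X)^b` and `d ∤ q`, and all `(a, q) = 1`. Proof: as for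
`PageUniformPNT.chebyshevPsiMod_uniform` with `T = (log X)^b` and `d` from
`exists_exceptionalConductor` (every real zero mod `q`, `d ∤ q`, has `1 − β ≥ c_P/T`), the explicit
Landau estimate `ClassicalPsiData.abs_psi_sub_le_explicit` at the height `x ≥ X`
(`exp(−c√log x) ≤ exp(−c√log X)`), and `exceptionalConductor_ge` for the size of `d`.
[cite: MontgomeryVaughan2007, Corollary 11.17, Corollary 11.10 and Corollary 11.15]
[cite: FriedlanderGranville1992, §4] -/
theorem chebyshevPsiMod_uniform_conductor {b : ℝ} (hb0 : 0 < b) (hb : b < 1 / 4) {ε : ℝ}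
    (hε : 0 < ε) {A : ℝ} (hA : 0 < A) :
    ∃ X₀ : ℝ, ∀ X : ℝ, X₀ ≤ X → ∃ d : ℕ, (d = 0 ∨ Real.log X ^ A ≤ (d : ℝ)) ∧
      ∀ q : ℕ, 1 ≤ q → Real.log q ≤ Real.log X ^ b → ¬ d ∣ q → ∀ a : (ZMod q)ˣ,
        ∀ x : ℝ, X ≤ x →
          |Literature.NumberTheory.Sieve.ParityWave0.chebyshevPsiMod q a x - x / q.totient| ≤
            ε * (x / q.totient) := by
  obtain ⟨c₃, cζ, Cζ, C₃, hc₃, hcζ, hCζ, hC₃, hData⟩ := exists_classicalPsiData_of_realZeros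
  obtain ⟨cP, hcP, hcPhalf, hPage⟩ := exists_exceptionalConductor
  obtain ⟨T₀, hT₀1, hSiegel⟩ := exceptionalConductor_ge hcP (A := A / b) (by positivity)
  -- absolute constants
  set m₁ : ℝ := min (min (c₃ / 2) (cP / 8)) (min cζ (1 / 4)) with hm₁
  have hm₁0 : 0 < m₁ := lt_min (lt_min (by positivity) (by positivity)) (lt_min hcζ (by norm_num))
  have hm₁a : m₁ ≤ c₃ / 2 := (min_le_left _ _).trans (min_le_left _ _)
  have hm₁b : m₁ ≤ cP / 8 := (min_le_left _ _).trans (min_le_right _ _)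
  have hm₁c : m₁ ≤ cζ := (min_le_right _ _).trans (min_le_left _ _)
  have hm₁d : m₁ ≤ 1 / 4 := (min_le_right _ _).trans (min_le_right _ _)
  clear_value m₁
  set m₂ : ℝ := min (cP / 2) 1 with hm₂
  have hm₂0 : 0 < m₂ := lt_min (by positivity) one_pos
  have hm₂a : m₂ ≤ cP / 2 := min_le_left _ _
  have hm₂b : m₂ ≤ 1 := min_le_right _ _
  clear_value m₂
  set e : ℝ := Real.exp 1 with he
  have he0 : 0 < e := Real.exp_pos 1
  set k₁ : ℝ := Cζ + 3 + 64 * C₃ / m₂ with hk₁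
  have hk₁0 : 0 ≤ k₁ := by rw [hk₁]; positivity
  set k₂ : ℝ := k₁ * (32 * e + 144 * Real.pi / m₁) + 1 with hk₂
  have hk₂0 : 0 ≤ k₂ := by rw [hk₂]; positivity
  set k₃ : ℝ := 1 / 4 + 8 * k₂ + 9 * e ^ 2 with hk₃
  have hk₃0 : 0 ≤ k₃ := by rw [hk₃]; positivity
  -- the exponents
  set η : ℝ := 1 / 2 - b with hηdef
  have hη0 : 0 < η := by rw [hηdef]; linarith
  set γ : ℝ := b / η with hγdef
  have hγ1 : γ < 1 := by rw [hγdef, div_lt_one hη0, hηdef]; linarith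
  have hγη : η * γ = b := by rw [hγdef]; field_simp
  -- the decay
  obtain ⟨u₀, hu₀⟩ := eventually_atTop.1
    (eventually_decay_le (m := m₁ / 24) (k := k₃) hγ1 (by positivity) hk₃0 hε)
  refine ⟨max (max (Real.exp ((max u₀ 1) ^ (1 / η))) (Real.exp 1)) (Real.exp (T₀ ^ (1 / b))),
    fun X hX ↦ ?_⟩
  -- `X`, `Lx = log X`, `T = Lx^b`, `u = Lx^η`
  have hX1 : Real.exp 1 ≤ X := ((le_max_right _ _).trans (le_max_left _ _)).trans hX
  have hX0 : 0 < X := (Real.exp_pos 1).trans_le hX1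
  have hX2 : 2 ≤ X := by
    have := Real.add_one_le_exp (1 : ℝ)
    linarith
  set Lx : ℝ := Real.log X with hLdef
  have hL1 : 1 ≤ Lx := by
    rw [hLdef, ← Real.log_exp 1]
    exact Real.log_le_log (Real.exp_pos 1) hX1
  have hL0 : 0 < Lx := by linarith
  have hLu : (max u₀ 1) ^ (1 / η) ≤ Lx := by
    rw [hLdef, ← Real.log_exp ((max u₀ 1) ^ (1 / η))]
    exact Real.log_le_log (Real.exp_pos _) (((le_max_left _ _).trans (le_max_left _ _)).trans hX)
  have hLT₀ : T₀ ^ (1 / b) ≤ Lx := by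
    rw [hLdef, ← Real.log_exp (T₀ ^ (1 / b))]
    exact Real.log_le_log (Real.exp_pos _) ((le_max_right _ _).trans hX)
  set T : ℝ := Lx ^ b with hTdef
  have hT1 : 1 ≤ T := Real.one_le_rpow hL1 hb0.le
  have hT0 : 0 < T := by linarith
  have hT₀T : T₀ ≤ T := by
    have h0 : 0 ≤ T₀ := zero_le_one.trans hT₀1
    have : T₀ = (T₀ ^ (1 / b)) ^ b := by
      rw [← Real.rpow_mul h0, one_div_mul_cancel hb0.ne', Real.rpow_one]
    rw [this, hTdef]
    exact Real.rpow_le_rpow (Real.rpow_nonneg h0 _) hLT₀ hb0.le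
  set u : ℝ := Lx ^ η with hudef
  have hu1 : max u₀ 1 ≤ u := by
    have h0 : 0 ≤ max u₀ 1 := le_trans zero_le_one (le_max_right _ _)
    have : (max u₀ 1) = ((max u₀ 1) ^ (1 / η)) ^ η := by
      rw [← Real.rpow_mul h0, one_div_mul_cancel hη0.ne', Real.rpow_one]
    rw [this, hudef]
    exact Real.rpow_le_rpow (Real.rpow_nonneg h0 _) hLu hη0.le
  have hu₀u : u₀ ≤ u := (le_max_left _ _).trans hu1
  have hupos : 0 < u := lt_of_lt_of_le one_pos ((le_max_right _ _).trans hu1)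
  have hTu : T = u ^ γ := by
    rw [hudef, hTdef, ← Real.rpow_mul hL0.le, hγη]
  have hsqrt : Real.sqrt Lx = u * T := by
    rw [Real.sqrt_eq_rpow, hudef, hTdef, ← Real.rpow_add hL0, hηdef]
    norm_num
  have hdecay := hu₀ u hu₀u
  -- Page, conductor form
  obtain ⟨d, hdor, hP⟩ := hPage T hT1
  have hcPT : cP / T ≤ 1 / 2 := (div_le_self hcP.le hT1).trans hcPhalf
  refine ⟨d, ?_, fun q hq hqT hndvd a x hXx ↦ ?_⟩
  · -- the size of `d`
    rcases hdor with h0 | ⟨q₀, _, χ₀, β₀, -, hχ₀2, hχ₀1, hβ₀, hβ₀lt, rfl⟩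
    · exact Or.inl h0
    · refine Or.inr ?_
      have h := hSiegel T hT₀T hcPT q₀ χ₀ β₀ hχ₀2 hχ₀1 hβ₀ hβ₀lt
      have hTA : T ^ (A / b) = Lx ^ A := by
        rw [hTdef, ← Real.rpow_mul hL0.le, mul_div_cancel₀ _ hb0.ne']
      rwa [hTA] at h
  haveI : NeZero q := ⟨by omega⟩
  have ha : IsUnit (a : ZMod q) := Units.isUnit a
  have hq1 : (1 : ℝ) ≤ q := by exact_mod_cast hq
  have hq0 : (0 : ℝ) < q := by linarith
  have hlogq0 : 0 ≤ Real.log q := Real.log_nonneg hq1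
  have hqexpT : (q : ℝ) ≤ Real.exp T := by
    rw [← Real.exp_log hq0]; exact Real.exp_le_exp.2 hqT
  have hx2 : 2 ≤ x := hX2.trans hXx
  have hx0 : 0 < x := by linarith
  -- the real zeros mod `q`
  have hηq : ∀ χ : DirichletCharacter ℂ q, χ ^ 2 = 1 → χ ≠ 1 → ∀ β : ℝ, χ.LFunction β = 0 →
      cP / T ≤ 1 - β := fun χ h2 h1 β hβ ↦ hP q hqT hndvd χ h2 h1 β hβ
  have hδ0 : 0 < cP / T := div_pos hcP hT0
  -- lower bounds for `c_q` and `d_q`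
  have hcq : m₁ / T ≤ min (min (c₃ / (1 + Real.log q)) (cP / T / 8)) (min cζ (1 / 4)) := by
    have hmT : m₁ / T ≤ m₁ := div_le_self hm₁0.le hT1
    refine le_min (le_min ?_ ?_) (le_min (hmT.trans hm₁c) (hmT.trans hm₁d))
    · calc m₁ / T ≤ (c₃ / 2) / T := div_le_div_of_nonneg_right hm₁a hT0.le
        _ = c₃ / (2 * T) := by rw [div_div]
        _ ≤ c₃ / (1 + Real.log q) := div_le_div_of_nonneg_left hc₃.le (by linarith) (by linarith)
    · calc m₁ / T ≤ (cP / 8) / T := div_le_div_of_nonneg_right hm₁b hT0.le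
        _ = cP / T / 8 := by ring
  have hdq : m₂ / T ≤ min (cP / T / 2) 1 := by
    refine le_min ?_ ((div_le_self hm₂0.le hT1).trans hm₂b)
    calc m₂ / T ≤ (cP / 2) / T := div_le_div_of_nonneg_right hm₂a hT0.le
      _ = cP / T / 2 := by ring
  -- the data and Landau's explicit estimate (at the height `x`)
  have hD := hData q (a : ZMod q) ha (cP / T) hδ0 hηq
  have hPsi := hD.abs_psi_sub_le_explicit hx2
  set cq : ℝ := min (min (c₃ / (1 + Real.log q)) (cP / T / 8)) (min cζ (1 / 4)) with hcqdef
  set dq : ℝ := min (cP / T / 2) 1 with hdqdef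
  have hcq0 : 0 < cq := lt_of_lt_of_le (div_pos hm₁0 hT0) hcq
  have hcq4 : cq ≤ 1 / 4 := (min_le_right _ _).trans (min_le_right _ _)
  have hdq0 : 0 < dq := lt_of_lt_of_le (div_pos hm₂0 hT0) hdq
  have hdq1 : dq ≤ 1 := min_le_right _ _
  clear_value cq dq
  have hcq2 : cq ≤ 1 / 2 := by linarith only [hcq4]
  have hmin : min cq (1 / 2) = cq := min_eq_left hcq2
  rw [hmin] at hPsi
  revert hPsi
  clear hD
  -- bounds for the pieces of the constant
  have hlog40 : 0 < Real.log 4 := Real.log_pos (by norm_num)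
  have hℒ₀ : Real.log q + Real.log 4 ≤ 4 * T := by linarith only [hqT, log_four_le_three, hT1]
  have hℒ₀0 : 0 ≤ Real.log q + Real.log 4 := by linarith only [hlogq0, hlog40]
  have hinvd : 1 / dq ≤ T / m₂ := by
    rw [div_le_div_iff₀ hdq0 hm₂0]
    have := (div_le_iff₀ hT0).1 hdq
    linarith only [this]
  have hinvc : 1 / cq ≤ T / m₁ := by
    rw [div_le_div_iff₀ hcq0 hm₁0]
    have := (div_le_iff₀ hT0).1 hcq
    linarith only [this]
  have hT4 : 1 ≤ T ^ 4 := one_le_pow₀ hT1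
  have hT5 : 1 ≤ T ^ 5 := one_le_pow₀ hT1
  have hTT4 : T ≤ T ^ 4 := le_self_pow₀ hT1 (by norm_num)
  have hqT4 : 1 ≤ (q : ℝ) * T ^ 4 := one_le_mul_of_one_le_of_one_le hq1 hT4
  have hqT5 : 1 ≤ (q : ℝ) * T ^ 5 := one_le_mul_of_one_le_of_one_le hq1 hT5
  -- `C_q ≤ k₁ q T⁴`
  have hCq : Cζ + 3 * Real.log q + q * (C₃ * ((Real.log q + Real.log 4) ^ 3 / dq)) ≤
      k₁ * (q * T ^ 4) := by
    have h1 : (Real.log q + Real.log 4) ^ 3 ≤ 64 * T ^ 3 := by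
      calc (Real.log q + Real.log 4) ^ 3 ≤ (4 * T) ^ 3 := pow_le_pow_left₀ hℒ₀0 hℒ₀ 3
        _ = 64 * T ^ 3 := by ring
    have h2 : (Real.log q + Real.log 4) ^ 3 / dq ≤ 64 * T ^ 3 * (T / m₂) := by
      rw [div_eq_mul_one_div]
      exact mul_le_mul h1 hinvd (by positivity) (by positivity)
    have h3 : q * (C₃ * ((Real.log q + Real.log 4) ^ 3 / dq)) ≤ q * (C₃ * (64 * T ^ 3 * (T / m₂))) :=
      mul_le_mul_of_nonneg_left (mul_le_mul_of_nonneg_left h2 hC₃) hq0.le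
    have h4 : q * (C₃ * (64 * T ^ 3 * (T / m₂))) = 64 * C₃ / m₂ * (q * T ^ 4) := by
      field_simp
    have h5 : Cζ ≤ Cζ * (q * T ^ 4) := le_mul_of_one_le_right hCζ hqT4
    have h6 : 3 * Real.log q ≤ 3 * (q * T ^ 4) := by
      have : Real.log q ≤ q * T ^ 4 := by
        calc Real.log q ≤ T := hqT
          _ ≤ T ^ 4 := hTT4
          _ = 1 * T ^ 4 := (one_mul _).symm
          _ ≤ q * T ^ 4 := mul_le_mul_of_nonneg_right hq1 (by positivity)
      linarith only [this]
    have eq : k₁ * (q * T ^ 4) = Cζ * (q * T ^ 4) + 3 * (q * T ^ 4) + 64 * C₃ / m₂ * (q * T ^ 4) := by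
      rw [hk₁]; ring
    linarith only [h3, h4, h5, h6, eq]
  -- `C_q (32e + 12π/(c_q/12)) + 1 ≤ k₂ q T⁵`
  have hTk : (Cζ + 3 * Real.log q + q * (C₃ * ((Real.log q + Real.log 4) ^ 3 / dq))) *
      (32 * Real.exp 1 + 12 * Real.pi / (cq / 12)) + 1 ≤ k₂ * (q * T ^ 5) := by
    have hπ : 0 < Real.pi := Real.pi_pos
    have h1 : 12 * Real.pi / (cq / 12) = 144 * Real.pi * (1 / cq) := by field_simp; ring
    have h2 : 12 * Real.pi / (cq / 12) ≤ 144 * Real.pi / m₁ * T := by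
      rw [h1]
      calc 144 * Real.pi * (1 / cq) ≤ 144 * Real.pi * (T / m₁) :=
            mul_le_mul_of_nonneg_left hinvc (by positivity)
        _ = 144 * Real.pi / m₁ * T := by ring
    have h3 : 32 * Real.exp 1 + 12 * Real.pi / (cq / 12) ≤ (32 * e + 144 * Real.pi / m₁) * T := by
      rw [← he, add_mul]
      have : 32 * e ≤ 32 * e * T := le_mul_of_one_le_right (by positivity) hT1
      linarith only [h2, this]
    have hCq0 : 0 ≤ Cζ + 3 * Real.log q + q * (C₃ * ((Real.log q + Real.log 4) ^ 3 / dq)) := by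
      positivity
    have h32 : 0 ≤ 32 * Real.exp 1 + 12 * Real.pi / (cq / 12) := by positivity
    have hk₁U : 0 ≤ k₁ * (q * T ^ 4) := by positivity
    have h4 := mul_le_mul hCq h3 h32 hk₁U
    have h5 : k₁ * (q * T ^ 4) * ((32 * e + 144 * Real.pi / m₁) * T) =
        k₁ * (32 * e + 144 * Real.pi / m₁) * (q * T ^ 5) := by ring
    have e2 : k₂ * (q * T ^ 5) = k₁ * (32 * e + 144 * Real.pi / m₁) * (q * T ^ 5) + q * T ^ 5 := by
      rw [hk₂]; ring
    linarith only [h4, h5, hqT5, e2]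
  -- `ψ_Λ(6) ≤ 12 q`
  have hψ6 := SiegelWalfisz.psi_residue_six_le q (a : ZMod q)
  have hφq : (q.totient : ℝ) ≤ q := by exact_mod_cast Nat.totient_le q
  have hφ1 : (1 : ℝ) ≤ q.totient := by exact_mod_cast Nat.totient_pos.2 (NeZero.pos q)
  -- the full constant `K_q ≤ k₃ q T⁵`
  have hK : (1 / 4 + 8 * ((Cζ + 3 * Real.log q + q * (C₃ * ((Real.log q + Real.log 4) ^ 3 / dq))) *
      (32 * Real.exp 1 + 12 * Real.pi / (cq / 12)) + 1)) +
      (ClassicalPsiData.psi (fun n ↦ (q.totient : ℝ) * ArithmeticFunction.vonMangoldt.residueClass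
        (a : ZMod q) n) 6 + 6) * (Real.exp 2 / 2) ≤ k₃ * (q * T ^ 5) := by
    have h1 : Real.exp 2 = e ^ 2 := by rw [he, ← Real.exp_nat_mul]; norm_num
    have hqq : (q : ℝ) ≤ q * T ^ 5 := le_mul_of_one_le_right hq0.le hT5
    have h2 : (ClassicalPsiData.psi (fun n ↦ (q.totient : ℝ) *
        ArithmeticFunction.vonMangoldt.residueClass (a : ZMod q) n) 6 + 6) * (Real.exp 2 / 2) ≤
        9 * e ^ 2 * (q * T ^ 5) := by
      rw [h1]
      have h18 : ClassicalPsiData.psi (fun n ↦ (q.totient : ℝ) *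
          ArithmeticFunction.vonMangoldt.residueClass (a : ZMod q) n) 6 + 6 ≤ 18 * (q * T ^ 5) := by
        linarith only [hψ6, hφq, hqq, hqT5]
      have he2 : 0 ≤ e ^ 2 / 2 := by positivity
      calc (ClassicalPsiData.psi (fun n ↦ (q.totient : ℝ) *
            ArithmeticFunction.vonMangoldt.residueClass (a : ZMod q) n) 6 + 6) * (e ^ 2 / 2)
          ≤ 18 * (q * T ^ 5) * (e ^ 2 / 2) := mul_le_mul_of_nonneg_right h18 he2
        _ = 9 * e ^ 2 * (q * T ^ 5) := by ring
    have e3 : k₃ * (q * T ^ 5) = 1 / 4 * (q * T ^ 5) + 8 * (k₂ * (q * T ^ 5)) + 9 * e ^ 2 * (q * T ^ 5) := by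
      rw [hk₃]; ring
    linarith only [hTk, h2, hqT5, e3]
  -- the exponential factor, at the height `x ≥ X`
  have hexp : Real.exp (-(cq / 12 / 2) * Real.sqrt (Real.log x)) ≤ Real.exp (-(m₁ / 24 * u)) := by
    rw [Real.exp_le_exp]
    have hsx : Real.sqrt Lx ≤ Real.sqrt (Real.log x) :=
      Real.sqrt_le_sqrt (by rw [hLdef]; exact Real.log_le_log hX0 hXx)
    rw [hsqrt] at hsx
    have h1 : m₁ * u ≤ cq * (u * T) := by
      have := (div_le_iff₀ hT0).1 hcq
      calc m₁ * u ≤ (cq * T) * u := mul_le_mul_of_nonneg_right this hupos.le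
        _ = cq * (u * T) := by ring
    have h2 : cq * (u * T) ≤ cq * Real.sqrt (Real.log x) := mul_le_mul_of_nonneg_left hsx hcq0.le
    have e4 : -(cq / 12 / 2) * Real.sqrt (Real.log x) = -(cq * Real.sqrt (Real.log x)) / 24 := by ring
    have e5 : -(m₁ / 24 * u) = -(m₁ * u) / 24 := by ring
    rw [e4, e5]
    linarith only [h1, h2]
  -- assemble: `|φ(q)ψ(x;q,a) − x| ≤ k₃ q T⁵ x e^{−m₁u/24} ≤ ε x`
  intro hPsi
  have hmain : |(q.totient : ℝ) * Literature.NumberTheory.Sieve.ParityWave0.chebyshevPsiMod q a x - x| ≤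
      k₃ * (q * T ^ 5) * x * Real.exp (-(m₁ / 24 * u)) := by
    rw [← SiegelWalfisz.psi_residue_eq]
    refine hPsi.trans ?_
    have hKnn : 0 ≤ k₃ * (q * T ^ 5) := by positivity
    exact mul_le_mul (mul_le_mul_of_nonneg_right hK hx0.le) hexp (Real.exp_pos _).le
      (mul_nonneg hKnn hx0.le)
  have hsmall : k₃ * (q * T ^ 5) * Real.exp (-(m₁ / 24 * u)) ≤ ε := by
    refine le_trans ?_ hdecay
    have hT5' : T ^ 5 = u ^ (5 * γ) := by
      rw [hTu, ← Real.rpow_natCast, ← Real.rpow_mul hupos.le]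
      ring_nf
    have hqexp : (q : ℝ) ≤ Real.exp (u ^ γ) := by rw [← hTu]; exact hqexpT
    have : k₃ * (q * T ^ 5) * Real.exp (-(m₁ / 24 * u)) =
        k₃ * u ^ (5 * γ) * q * Real.exp (-(m₁ / 24 * u)) := by rw [hT5']; ring
    rw [this]
    have hnn : 0 ≤ k₃ * u ^ (5 * γ) := mul_nonneg hk₃0 (Real.rpow_nonneg hupos.le _)
    exact mul_le_mul_of_nonneg_right (mul_le_mul_of_nonneg_left hqexp hnn) (Real.exp_pos _).le
  -- conclude
  have hφ0 : (0 : ℝ) < q.totient := by linarith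
  have hdiv : |Literature.NumberTheory.Sieve.ParityWave0.chebyshevPsiMod q a x - x / q.totient| =
      |(q.totient : ℝ) * Literature.NumberTheory.Sieve.ParityWave0.chebyshevPsiMod q a x - x| / q.totient := by
    rw [← abs_of_pos hφ0, ← abs_div, abs_of_pos hφ0]
    congr 1
    field_simp
  rw [hdiv, div_le_iff₀ hφ0]
  calc |(q.totient : ℝ) * Literature.NumberTheory.Sieve.ParityWave0.chebyshevPsiMod q a x - x|
      ≤ k₃ * (q * T ^ 5) * x * Real.exp (-(m₁ / 24 * u)) := hmain
    _ = (k₃ * (q * T ^ 5) * Real.exp (-(m₁ / 24 * u))) * x := by ring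
    _ ≤ ε * x := mul_le_mul_of_nonneg_right hsmall hx0.le
    _ = ε * (x / q.totient) * q.totient := by field_simp

/-- For `q ≥ 1`, the case `d = 0` of the exceptional conductor excludes nothing: `¬ 0 ∣ q`.
[folklore] -/
theorem not_zero_dvd_of_one_le {q : ℕ} (hq : 1 ≤ q) : ¬ (0 : ℕ) ∣ q := by
  rintro ⟨k, hk⟩
  omega

end Literature.NumberTheory.LFunctions.PageUniformPNT
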